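import Literature.NumberTheory.Transcendental.RoySmallValueZeroSeparation
import Literature.NumberTheory.Transcendental.RoySmallValueLevels
import HarnessLib

/-!
# Roy's small value estimate for `𝔾ₐ × 𝔾ₘ` — §7 Step 3: `D* → ∞` (uniform separation over finitely many levels)

Topic `Literature/NumberTheory/Transcendental`. Part of the formalisation of the proof of Roy 2013,
Theorem 1.1 (named fact `roy2013_thm_1_1`, `RoySmallValueEstimates.lean`), seat B. Source: D. Roy,
*A small value estimate for `𝔾ₐ × 𝔾ₘ`*, Mathematika 59 (2013) 333–363 = arXiv:1301.0663, §7,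
Step 3 (p. 19 of the arXiv text):

> Moreover, `D*` goes to infinity with `D` because, as `P̃_{D*+1}` is not divisible by `X₀` nor by
> `X₂`, it follows from Lemma 6.3 that `𝒵(𝒟ⁱP̃_{D*+1} ; 0 ≤ i ≤ D*+1)(ℂ)` is a finite subset of
> `ℙ²(ℚ̄)` and so, for fixed `D* ≥ 1`, this set does not contain the point `α₀` of `Z(ℂ)` when `D`
> is large enough.

Quantitatively: for FINITELY many levels (level packages `L_n : LevelPkg n P̃_n` of the parallel
seat, `n` in a finite set) there is ONE `ε > 0` such that every sup-normalised common zero of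
`P̃_n, Q_n` is at projective distance `≥ ε` from `(1 : ξ : η)` (`exists_pdist_lower_bound_levels`),
when `(ξ, η)` are not both algebraic — so a point `α₀` with `dist(α₀, (1:γ)) < ε` rules out all these
levels at once. Ingredients: `exists_pdist_lower_bound` (`RoySmallValueZeroSeparation`) level by
level, `isRelPrime_of_regular` (the package's regularity hypothesis gives coprimality), and a
minimum over the finite set. Everything is proved; no definitions, no named facts.

## References

* [Roy2013] D. Roy, *A small value estimate for 𝔾ₐ × 𝔾ₘ*, Mathematika 59 (2013), 333–363
  (arXiv:1301.0663), §7, Step 3 ("`D*` goes to infinity with `D`").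
-/

noncomputable section

open MvPolynomial Finset

namespace Literature.NumberTheory.Transcendental

namespace Roy2013

/-- **Regularity of `Q` modulo `P ≠ 0` gives coprimality.** [folklore] -/
theorem isRelPrime_of_regular {P Q : CX} (hP0 : P ≠ 0)
    (hreg : ∀ f : CX, Q * f ∈ Ideal.span {P} → f ∈ Ideal.span {P}) : IsRelPrime P Q := by
  intro d hdP hdQ
  obtain ⟨P', hP'⟩ := hdP
  obtain ⟨Q', hQ'⟩ := hdQ
  have hP'0 : P' ≠ 0 := by rintro rfl; exact hP0 (by rw [hP', mul_zero])
  -- `Q P' = Q' P ∈ (P)`, hence `P ∣ P'`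
  have h1 : Q * P' ∈ Ideal.span {P} := Ideal.mem_span_singleton.mpr ⟨Q', by rw [hQ', hP']; ring⟩
  obtain ⟨c, hc⟩ := Ideal.mem_span_singleton.mp (hreg P' h1)
  -- `P' = P c = d P' c`, so `d c = 1`
  have h2 : P' * 1 = P' * (d * c) := by
    calc P' * 1 = P' := mul_one _
      _ = P * c := hc
      _ = P' * (d * c) := by rw [hP']; ring
  have h3 := mul_left_cancel₀ hP'0 h2
  exact IsUnit.of_mul_eq_one c h3.symm

/-- Uniform separation over a finite set of levels, abstract form: finitely many pairs of coprime
rational forms. [cite: Roy2013, §7, Step 3] -/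
theorem exists_pdist_lower_bound_finset {κ : Type*} (s : Finset κ) {ξ η : ℂ}
    (hna : ¬(IsAlgebraic ℚ ξ ∧ IsAlgebraic ℚ η)) (P Q : κ → QX) (Dg : κ → ℕ)
    (hP : ∀ i ∈ s, (P i).IsHomogeneous (Dg i)) (hQ : ∀ i ∈ s, (Q i).IsHomogeneous (Dg i))
    (hP0 : ∀ i ∈ s, toCX (P i) ≠ 0) (hQ0 : ∀ i ∈ s, toCX (Q i) ≠ 0)
    (hPQ : ∀ i ∈ s, IsRelPrime (toCX (P i)) (toCX (Q i))) :
    ∃ ε : ℝ, 0 < ε ∧ ∀ i ∈ s, ∀ α : Fin 3 → ℂ, ‖α‖ = 1 → eval α (toCX (P i)) = 0 →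
      eval α (toCX (Q i)) = 0 → ε ≤ pdist ξ η α := by
  classical
  induction s using Finset.induction_on with
  | empty => exact ⟨1, one_pos, fun i hi => absurd hi (Finset.notMem_empty i)⟩
  | insert a s ha ih =>
    obtain ⟨ε₁, hε₁, h₁⟩ := ih (fun i hi => hP i (mem_insert_of_mem hi))
      (fun i hi => hQ i (mem_insert_of_mem hi)) (fun i hi => hP0 i (mem_insert_of_mem hi))
      (fun i hi => hQ0 i (mem_insert_of_mem hi)) (fun i hi => hPQ i (mem_insert_of_mem hi))
    obtain ⟨ε₂, hε₂, h₂⟩ := exists_pdist_lower_bound hna (hP a (mem_insert_self a s))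
      (hQ a (mem_insert_self a s)) (hP0 a (mem_insert_self a s)) (hQ0 a (mem_insert_self a s))
      (hPQ a (mem_insert_self a s))
    refine ⟨min ε₁ ε₂, lt_min hε₁ hε₂, fun i hi α hα hPα hQα => ?_⟩
    rcases mem_insert.mp hi with rfl | hi'
    · exact (min_le_right _ _).trans (h₂ α hα hPα hQα)
    · exact (min_le_left _ _).trans (h₁ i hi' α hα hPα hQα)

/-- **`D* → ∞`, quantitative form for level packages**: for finitely many levels `n ∈ s` with
packages `L_n : LevelPkg n (P̃ n)`, one `ε > 0` separates `(1:γ)` from all sup-normalised common zeros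
of `P̃_n, Q_n`, `n ∈ s`. [cite: Roy2013, §7, Step 3 ("for fixed `D*`, this set does not contain the point `α₀` … when `D` is large enough")] -/
theorem exists_pdist_lower_bound_levels (s : Finset ℕ) {ξ η : ℂ}
    (hna : ¬(IsAlgebraic ℚ ξ ∧ IsAlgebraic ℚ η)) (Pt : ℕ → MvPolynomial (Fin 3) ℤ)
    (L : ∀ n, LevelPkg n (Pt n)) (hPt : ∀ n ∈ s, (map (Int.castRingHom ℂ) (Pt n)).IsHomogeneous n)
    (hPt0 : ∀ n ∈ s, map (Int.castRingHom ℂ) (Pt n) ≠ 0) :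
    ∃ ε : ℝ, 0 < ε ∧ ∀ n ∈ s, ∀ α : Fin 3 → ℂ, ‖α‖ = 1 →
      eval α (map (Int.castRingHom ℂ) (Pt n)) = 0 →
      eval α (map (Int.castRingHom ℂ) (levelQ n (Pt n) (L n).t)) = 0 → ε ≤ pdist ξ η α := by
  obtain ⟨ε, hε, h⟩ := exists_pdist_lower_bound_finset s hna
    (fun n => map (Int.castRingHom ℚ) (Pt n)) (fun n => map (Int.castRingHom ℚ) (levelQ n (Pt n) (L n).t))
    (fun n => n)
    (fun n hn => isHomogeneous_map_rat (hPt n hn))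
    (fun n hn => isHomogeneous_map_rat (isHomogeneous_map_levelQ (hPt n hn) (L n).t))
    (fun n hn => by rw [toCX_map_int]; exact hPt0 n hn)
    (fun n hn => by rw [toCX_map_int]; exact (L n).hQ0)
    (fun n hn => by rw [toCX_map_int, toCX_map_int]; exact isRelPrime_of_regular (hPt0 n hn) (L n).hPQ)
  refine ⟨ε, hε, fun n hn α hα hP hQ => h n hn α hα ?_ ?_⟩
  · rw [toCX_map_int]; exact hP
  · rw [toCX_map_int]; exact hQ

end Roy2013

end Literature.NumberTheory.Transcendental
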